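import Literature.AlgebraicGeometry.ModuliOfAbelianVarieties.SymplecticLiftOfMarking      -- ★ (b) `SiegelAdelicMarking.exists_symplecticLift_of_levelReading`
import Literature.AlgebraicGeometry.AbelianSchemes.SymplecticLiftableOfOnePoint            -- ★ `LevelStructure.isSymplecticLiftable_of_nonempty_symplecticLift`
import HarnessLib

/-!
# A family whose fibre at ONE complex point is MARKED with level and pairing readings is symplectic-liftable over the connected base

Topic `AlgebraicGeometry/ModuliOfAbelianVarieties`; namespace `Literature.AlgebraicGeometry.ModuliOfAbelianVarieties`.  THEOREMS ONLY (no definition, no named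
fact, no instance, no notation, no `sorry`; net debt 0).  Cell `hodgecm-mathlib`, FLOOR 0, P6 «MOD programme» (crux hLiu418 = stmt-HodgeConjecture-24832,
`--supports`), X-LEAF sheet line, organ **(S1b)(m4) «SYMPLECTIC LIFTABILITY OF THE TWISTED LEVEL STRUCTURE», ROAD (β) «MARKING ROAD AT ONE COMPLEX POINT PER
COMPONENT»** (E-side dealer A-p01 (g28) 2026-09-02T06:25:25Z: «file it as a ★ organ in marked-fibre currency that the (S8) closer calls»), LAYER [L1] — the GLUE.

THE MATHEMATICS ([Lan2013PELCompactifications] §1.3.6 Lemma 1.3.6.5–1.3.6.6, Cor. 1.3.6.7; [Deligne1971TravauxShimura] 4.12 (b); [Milne2005ShimuraVarieties] Thm. 6.11):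
symplectic liftability of a level structure is decided geometric point by geometric point, spreads from ONE geometric point over a connected (reduced, locally
Noetherian, characteristic-`0`) base (★ `LevelStructure.isSymplecticLiftable_of_nonempty_symplecticLift`, Lan Cor. 1.3.6.7), and AT a complex point a symplectic
lift is BUILT from an adelic marking `[J, r]` of the fibre whose level sections and Weil pairing are READ through `r` (★ (b) `SiegelAdelicMarking.exists_symplecticLift_of_levelReading`,
Milne՚s `η = u ∘ a`).  Composing the two:

* **`isSymplecticLiftable_of_markedComplexFibre`** — `B → S` an abelian scheme of relative dimension `g` over a preconnected reduced locally Noetherian `S`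
  on which every positive integer is invertible, `φ` a level-`N` structure (`N ≠ 0`), `pol` a polarisation, `s₀ : Spec ℂ → S` a complex point with a witness `Θ₀`
  (`IsLambdaOfAt`), `m` a marking of the fibre `B_{s₀}` by `[J, r]`, `ζ` a compatible system of primitive roots of unity, (`hpair`) the Weil pairing of `Θ₀` on
  torsion points read through `r` is `ζ_M ^ E_δ`, (`hlevel`) the sections `σᵢ(s₀)` are read through `r` at `eᵢ∕N`  ⟹  `φ.IsSymplecticLiftable pol δ`.

Consumer: the (S8) closer at the Serre-twisted family `(A ⊗ 𝔞⁻¹, λ′, η′)` over a component of `X_ℂ`, with the marking of the twisted fibre ★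
`SiegelAdelicMarking.exists_marking_of_idealKernel` (`mB.r = ψ_P ∘ m.r`) and the transferred readings (layer [L2]).  Budgets: default heartbeats.

References: [Lan2013PELCompactifications] K.-W. Lan, *Arithmetic compactifications of PEL-type Shimura varieties* (2013), §1.3.6 Def. 1.3.6.2 (p. 80), Lemma 1.3.6.5,
Lemma 1.3.6.6 and Cor. 1.3.6.7 (pp. 81–82); [Deligne1971TravauxShimura] P. Deligne, *Travaux de Shimura* (1971), 4.12 (b) p. 149, 4.16 p. 150;
[Milne2005ShimuraVarieties] J. S. Milne, *Introduction to Shimura varieties* (2005), §6 Thm. 6.11 p. 74 and §12 (63) p. 116; [MumfordFogartyKirwan1994] Ch. 7 §2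
Prop. 7.3 (pp. 133–134).
HC_CM is proved only modulo the printed citations (2 remaining named inputs hLiu418 24832, h413 24833) until rung 0 closes — count-neutral.
-/

set_option autoImplicit false

noncomputable section

open Matrix CategoryTheory AlgebraicGeometry
open Literature.AlgebraicGeometry.Motives (AbelianVariety AlgPoints CartierDivisor)
open Literature.AlgebraicGeometry.AbelianSchemes (AbelianSchemeOver)
open Literature.NumberTheory.Adeles (latticeOfGL)

namespace Literature.AlgebraicGeometry.ModuliOfAbelianVarieties

open SiegelModuli

/-- **ONE MARKED COMPLEX FIBRE WITH READINGS ⇒ SYMPLECTIC-LIFTABLE OVER THE CONNECTED BASE** (★ (b) `exists_symplecticLift_of_levelReading` at `s₀` + ★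
`LevelStructure.isSymplecticLiftable_of_nonempty_symplecticLift`, Lan Lemma 1.3.6.5 + Cor. 1.3.6.7): for `B → S` of relative dimension `g` over a preconnected reduced
locally Noetherian base `S` on which every positive integer is invertible, a level-`N` structure `φ` (`N ≠ 0`), a polarisation `pol`, a complex point `s₀` with a
witness `Θ₀` of `λ̄` there, a marking `m` of `B_{s₀}` by `[J, r]`, compatible primitive roots `ζ`, the pairing reading (`hpair`) and the level reading (`hlevel`)
through `r`: `φ` is symplectic-liftable of type `δ` for `pol`. [cite: Lan2013PELCompactifications, §1.3.6 Lemma 1.3.6.5 (p. 81), Lemma 1.3.6.6 and Cor. 1.3.6.7 (pp. 81–82)]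
[cite: Deligne1971TravauxShimura, 4.12 (b) p. 149] [cite: Milne2005ShimuraVarieties, §6 Thm. 6.11 p. 74 and §12 (63) p. 116] -/
theorem isSymplecticLiftable_of_markedComplexFibre {g : ℕ} {δ : Fin g → ℕ} {J : C0pm δ} {r : gspFinAdelic δ}
    {S : Scheme.{0}} [PreconnectedSpace S] [IsLocallyNoetherian S] [IsReduced S] {B : AbelianSchemeOver S}
    (hg : B.IsOfRelDim g) (hQ : ∀ M : ℕ, M ≠ 0 → ∀ s : S, (M : S.residueField s) ≠ 0)
    {N : ℕ} (φ : B.LevelStructure g N) (hN : N ≠ 0) {D : B.DualPair} (pol : B.Polarization D)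
    {s₀ : Spec (.of ℂ) ⟶ S} (Θ₀ : CartierDivisor (B.fibre s₀).toAbelianVariety.X.left) (hΘ₀ : B.IsLambdaOfAt s₀ D pol.lam Θ₀)
    (m : SiegelAdelicMarking J r (B.fibre s₀).toAbelianVariety)
    (ζ : ℕ → ℂ) (hζ : ∀ ⦃M : ℕ⦄, N ∣ M → M ≠ 0 → IsPrimitiveRoot (ζ M) M)
    (hζ_pow : ∀ ⦃M : ℕ⦄ (k : ℕ), N ∣ M → M ≠ 0 → k ≠ 0 → ζ (k * M) ^ k = ζ M)
    (hpair : ∀ ⦃M : ℕ⦄, N ∣ M → ∀ (hMΩ : (M : ℂ) ≠ 0) (x y : Fin g ⊕ Fin g → ZMod M)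
      (P Q : (B.fibre s₀).toAbelianVariety.torsionPoints ℂ (M : ℤ)),
      (∀ v, AdelicCongr ((r⁻¹ : gspFinAdelic δ) : GL (Fin g ⊕ Fin g) finAdeleQ) 1 v
          (fun i => ((x i).val : ℚ) / M) → (P : (B.fibre s₀).toAbelianVariety.Points ℂ) = m.r v) →
      (∀ w, AdelicCongr ((r⁻¹ : gspFinAdelic δ) : GL (Fin g ⊕ Fin g) finAdeleQ) 1 w
          (fun i => ((y i).val : ℚ) / M) → (Q : (B.fibre s₀).toAbelianVariety.Points ℂ) = m.r w) →
      haveI := AbelianVariety.isDominant_toSchemeHom_zsmul_of_ne_zero (B.fibre s₀).toAbelianVariety hMΩ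
      (B.fibre s₀).toAbelianVariety.weilPairingLevel Θ₀ P Q = ζ M ^ (AbelianSchemeOver.typeFormMod δ M x y).val)
    (hlevel : ∀ i : Fin g ⊕ Fin g, ∃ v : Fin g ⊕ Fin g → ℚ,
      AdelicCongr ((r⁻¹ : gspFinAdelic δ) : GL (Fin g ⊕ Fin g) finAdeleQ) 1 v
          (fun j => (((Pi.single i (1 : ZMod N) : Fin g ⊕ Fin g → ZMod N) j).val : ℚ) / N) ∧
        B.restrictPt s₀ (φ.σ i) = m.r v) :
    φ.IsSymplecticLiftable pol δ := by
  obtain ⟨Λ₀, -, -⟩ := SiegelAdelicMarking.exists_symplecticLift_of_levelReading φ Θ₀ m ζ hζ hζ_pow hpair hlevel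
  exact AbelianSchemeOver.LevelStructure.isSymplecticLiftable_of_nonempty_symplecticLift hg hQ φ hN pol δ s₀ Θ₀ hΘ₀ Λ₀

end Literature.AlgebraicGeometry.ModuliOfAbelianVarieties

end
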